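import Literature.Geometry.GeometricMeasureTheory.GraphHomotopy
import Literature.Geometry.GeometricMeasureTheory.ChartCurrent
import Mathlib.Analysis.InnerProductSpace.ProdL2
import Mathlib.MeasureTheory.Measure.Haar.InnerProductSpace

/-!
# The graph homotopy current is a rectifiable current

In the situation of `GraphHomotopy.lean` — `Φ(t, k) = ι k + t · u k` with `ι : K →L[ℝ] V`,
`u : K → V` smooth and compactly supported — suppose that a continuous linear `π₁ : V →L[ℝ] K`
is a left inverse of `ι` killing `u` (`π₁ ∘ ι = id`, `π₁ ∘ u = 0`; e.g. `u` with values in a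
closed complement of `ι(K)`). Then `Φ` is an injective immersion on the **good parameter set**
`A = (0,1) × {u ≠ 0}`, with the explicit left inverse
`ℓ(y) = (⟪y − ι π₁ y, u(π₁ y)⟫ / ‖u(π₁ y)‖², π₁ y)`, and:

* `approxTangentCone_graphHomotopy_eq` : `Tan^{n+1}(𝓗^{n+1} ⌞ Φ(A), Φ z) = im DΦ(z)` for `z ∈ A`
  (the chart theorem of `ChartCurrent.lean`/`ApproxTangentChart.lean`, Federer 3.2.19, in the
  Euclidean parameter space `WithLp 2 (ℝ × K)`);
* `exists_graphHomotopyCurrent_isRectifiable` : the homotopy current `S` of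
  `exists_graphHomotopyCurrent` (with `μ = vol`) is `k • [Φ(A), 1, ξ]`-rectifiable: for every
  `k : ℤ`, `k • S` is a **rectifiable current** on any open `Ω' ⊇ Φ([0,1] × spt u)`
  (Federer 4.1.9 with 4.1.28: `h_#(⟦0,1⟧ × T) ∈ 𝓡_{n+1}` for `T = 𝐄ⁿ ⌞ {u ≠ 0}`).

## References

* H. Federer, *Geometric Measure Theory*, Springer 1969, 3.2.19, 4.1.9, 4.1.28 [Federer1969].
-/

noncomputable section

open scoped InnerProductSpace ENNReal NNReal Topology ContDiff
open MeasureTheory Measure Set Function Module TopologicalSpace Filter Metric WithLp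

namespace Literature.Geometry.GeometricMeasureTheory

open Literature.Analysis.Calculus

-- Nested operator-norm instances on (duals of) `V [⋀^Fin m]→L[ℝ] ℝ`.
set_option maxSynthPendingDepth 2

/-! ### The Euclidean parameter space `WithLp 2 (ℝ × K)` -/

section Basis

variable {K : Type*} [NormedAddCommGroup K] [InnerProductSpace ℝ K] [FiniteDimensional ℝ K]
  {n : ℕ}

/-- The frame `(toLp (1,0), toLp (0,e₁), …, toLp (0,eₙ))` of `WithLp 2 (ℝ × K)`. [folklore] -/
def slabFrameL2 (e : Fin n → K) : Fin (n + 1) → WithLp 2 (ℝ × K) :=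
  fun i => toLp 2 (slabFrame e i)

omit [InnerProductSpace ℝ K] [FiniteDimensional ℝ K] in
/-- `ofLp (slabFrameL2 e i) = slabFrame e i`. [folklore] -/
@[simp] theorem ofLp_slabFrameL2 (e : Fin n → K) (i : Fin (n + 1)) :
    ofLp (slabFrameL2 e i) = slabFrame e i := rfl

omit [FiniteDimensional ℝ K] in
/-- The frame `slabFrameL2 e` is orthonormal when `e` is. [folklore] -/
theorem orthonormal_slabFrameL2 {e : Fin n → K} (he : Orthonormal ℝ e) :
    Orthonormal ℝ (slabFrameL2 e) := by
  rw [orthonormal_iff_ite] at he ⊢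
  intro i j
  refine Fin.cases ?_ (fun i' => ?_) i <;> refine Fin.cases ?_ (fun j' => ?_) j
  · simp [slabFrameL2]
  · simp [slabFrameL2, prod_inner_apply, (Fin.succ_ne_zero j').symm]
  · simp [slabFrameL2, prod_inner_apply, Fin.succ_ne_zero i']
  · simp [slabFrameL2, prod_inner_apply, he i' j', Fin.succ_inj]

/-- `dim WithLp 2 (ℝ × K) = n + 1` when `dim K = n`. [folklore] -/
theorem finrank_withLp_real_prod (e : OrthonormalBasis (Fin n) ℝ K) :
    finrank ℝ (WithLp 2 (ℝ × K)) = n + 1 := by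
  rw [(WithLp.linearEquiv 2 ℝ (ℝ × K)).finrank_eq, finrank_prod, finrank_self,
    finrank_eq_of_orthonormalBasis_fin e, add_comm]

/-- The orthonormal basis `(toLp (1,0), toLp (0,e₁), …, toLp (0,eₙ))` of `WithLp 2 (ℝ × K)`.
[folklore] -/
def slabBasisL2 (e : OrthonormalBasis (Fin n) ℝ K) : OrthonormalBasis (Fin (n + 1)) ℝ (WithLp 2 (ℝ × K)) :=
  (basisOfOrthonormalOfCardEqFinrank (orthonormal_slabFrameL2 e.orthonormal)
    (by rw [Fintype.card_fin, finrank_withLp_real_prod e])).toOrthonormalBasis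
    (by
      rw [coe_basisOfOrthonormalOfCardEqFinrank]
      exact orthonormal_slabFrameL2 e.orthonormal)

/-- `slabBasisL2 e i = toLp (slabFrame e i)`. [folklore] -/
@[simp] theorem slabBasisL2_apply (e : OrthonormalBasis (Fin n) ℝ K) (i : Fin (n + 1)) :
    slabBasisL2 e i = toLp 2 (slabFrame e i) := by
  rw [slabBasisL2, Basis.coe_toOrthonormalBasis, coe_basisOfOrthonormalOfCardEqFinrank]
  rfl

end Basis

/-! ### The graph homotopy as an injective immersion on the good set -/

section Immersion

variable {K : Type*} [NormedAddCommGroup K] [InnerProductSpace ℝ K]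
  {V : Type*} [NormedAddCommGroup V] [InnerProductSpace ℝ V]
  (ι : K →L[ℝ] V) (π₁ : V →L[ℝ] K) {u : K → V}

/-- `π₁ ∘ Du = 0` when `π₁ ∘ u = 0`. [folklore] -/
theorem apply_fderiv_eq_zero_of_comp_eq_zero (hu : ContDiff ℝ ∞ u) (hπu : ∀ k, π₁ (u k) = 0)
    (k w : K) : π₁ (fderiv ℝ u k w) = 0 := by
  have hd : HasFDerivAt u (fderiv ℝ u k) k :=
    (hu.differentiable (by simp)).differentiableAt.hasFDerivAt
  have h1 : HasFDerivAt (fun y => π₁ (u y)) (π₁.comp (fderiv ℝ u k)) k := π₁.hasFDerivAt.comp k hd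
  have h0 : (fun y => π₁ (u y)) = fun _ => (0 : K) := funext hπu
  have h2 : fderiv ℝ (fun y => π₁ (u y)) k w = 0 := by
    rw [h0]
    simp
  rw [h1.fderiv] at h2
  simpa using h2

/-- `π₁ (Φ(t, k)) = k`. [folklore] -/
theorem apply_pi_graphHomotopy (hπι : ∀ k, π₁ (ι k) = k) (hπu : ∀ k, π₁ (u k) = 0)
    (z : ℝ × K) : π₁ (graphHomotopy ι u z) = z.2 := by
  simp [graphHomotopy_apply, hπι, hπu]

/-- The graph homotopy is injective on `{u ≠ 0}` (in the `K`-variable). [folklore] -/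
theorem injOn_graphHomotopy (hπι : ∀ k, π₁ (ι k) = k) (hπu : ∀ k, π₁ (u k) = 0) :
    InjOn (graphHomotopy ι u) {z : ℝ × K | u z.2 ≠ 0} := by
  intro z hz z' hz' h
  have h2 : z.2 = z'.2 := by
    have := congrArg π₁ h
    rwa [apply_pi_graphHomotopy ι π₁ hπι hπu, apply_pi_graphHomotopy ι π₁ hπι hπu] at this
  have h1 : z.1 = z'.1 := by
    have h' : z.1 • u z.2 = z'.1 • u z.2 := by
      have := h
      simp only [graphHomotopy_apply, ← h2] at this
      exact add_left_cancel this
    rw [← sub_eq_zero, ← sub_smul] at h'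
    exact sub_eq_zero.1 ((smul_eq_zero.1 h').resolve_right hz)
  exact Prod.ext h1 h2

/-- The differential of the graph homotopy is injective where `u ≠ 0`. [folklore] -/
theorem injective_fderiv_graphHomotopy (hu : ContDiff ℝ ∞ u) (hπι : ∀ k, π₁ (ι k) = k)
    (hπu : ∀ k, π₁ (u k) = 0) {z : ℝ × K} (hz : u z.2 ≠ 0) :
    Injective (fderiv ℝ (graphHomotopy ι u) z) := by
  rw [(hasFDerivAt_graphHomotopy ι hu z).fderiv]
  intro a b h
  have key : ∀ c : ℝ × K, (ι.comp (ContinuousLinearMap.snd ℝ ℝ K) +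
      (z.1 • (fderiv ℝ u z.2).comp (ContinuousLinearMap.snd ℝ ℝ K) +
        (ContinuousLinearMap.fst ℝ ℝ K).smulRight (u z.2))) c =
      ι c.2 + (z.1 • fderiv ℝ u z.2 c.2 + c.1 • u z.2) := fun c => by
    simp
  rw [key, key] at h
  have h2 : a.2 = b.2 := by
    have := congrArg π₁ h
    simpa [hπι, hπu, apply_fderiv_eq_zero_of_comp_eq_zero π₁ hu hπu] using this
  have h1 : a.1 = b.1 := by
    rw [h2] at h
    have h' : a.1 • u z.2 = b.1 • u z.2 := by
      have := add_left_cancel h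
      exact add_left_cancel this
    rw [← sub_eq_zero, ← sub_smul] at h'
    exact sub_eq_zero.1 ((smul_eq_zero.1 h').resolve_right hz)
  exact Prod.ext h1 h2

/-- The explicit left inverse `ℓ(y) = (⟪y − ι π₁ y, u(π₁ y)⟫ / ‖u(π₁ y)‖², π₁ y)` of the affine
homotopy (off `u ∘ π₁ = 0`). [folklore] -/
def graphHomotopyInv (u : K → V) (y : V) : ℝ × K :=
  (⟪y - ι (π₁ y), u (π₁ y)⟫_ℝ / ‖u (π₁ y)‖ ^ 2, π₁ y)

/-- `ℓ (Φ z) = z` whenever `u z.2 ≠ 0`. [folklore] -/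
theorem graphHomotopyInv_apply (hπι : ∀ k, π₁ (ι k) = k) (hπu : ∀ k, π₁ (u k) = 0)
    {z : ℝ × K} (hz : u z.2 ≠ 0) : graphHomotopyInv ι π₁ u (graphHomotopy ι u z) = z := by
  have hπ := apply_pi_graphHomotopy ι π₁ hπι hπu z
  have hne : ‖u z.2‖ ^ 2 ≠ 0 := pow_ne_zero 2 (norm_ne_zero_iff.2 hz)
  have hπ' : π₁ (ι z.2 + z.1 • u z.2) = z.2 := by simpa [graphHomotopy_apply] using hπ
  refine Prod.ext ?_ ?_
  · simp only [graphHomotopyInv, graphHomotopy_apply, hπ', add_sub_cancel_left,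
      real_inner_smul_left, real_inner_self_eq_norm_sq]
    field_simp
  · simp only [graphHomotopyInv, hπ]

/-- `ℓ` is smooth near every point `y` with `u (π₁ y) ≠ 0`. [folklore] -/
theorem contDiffAt_graphHomotopyInv (hu : ContDiff ℝ ∞ u) {y : V} (hy : u (π₁ y) ≠ 0) :
    ContDiffAt ℝ ∞ (graphHomotopyInv ι π₁ u) y := by
  have h1 : ContDiff ℝ ∞ fun y : V => u (π₁ y) := hu.comp π₁.contDiff
  have hnum : ContDiff ℝ ∞ fun y : V => ⟪y - ι (π₁ y), u (π₁ y)⟫_ℝ :=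
    (contDiff_id.sub (ι.contDiff.comp π₁.contDiff)).inner ℝ h1
  have hden : ContDiff ℝ ∞ fun y : V => ‖u (π₁ y)‖ ^ 2 := by
    simp_rw [← real_inner_self_eq_norm_sq]
    exact h1.inner ℝ h1
  have hne : ‖u (π₁ y)‖ ^ 2 ≠ 0 := pow_ne_zero 2 (norm_ne_zero_iff.2 hy)
  exact (hnum.contDiffAt.div hden.contDiffAt hne).prodMk π₁.contDiff.contDiffAt

end Immersion

/-! ### Tangent cones of the swept surface -/

section Tangent

variable {K : Type*} [NormedAddCommGroup K] [InnerProductSpace ℝ K] [FiniteDimensional ℝ K]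
  [MeasurableSpace K] [BorelSpace K]
  {V : Type*} [NormedAddCommGroup V] [InnerProductSpace ℝ V] [FiniteDimensional ℝ V]
  [MeasurableSpace V] [BorelSpace V] {n : ℕ}
  (ι : K →L[ℝ] V) (π₁ : V →L[ℝ] K) {u : K → V}

/-- The good parameter set `A = (0,1) × {u ≠ 0}`. [folklore] -/
def goodSet (u : K → V) : Set (ℝ × K) := Ioo (0 : ℝ) 1 ×ˢ {k | u k ≠ 0}

omit [InnerProductSpace ℝ K] [FiniteDimensional ℝ K] [MeasurableSpace K] [BorelSpace K]
  [InnerProductSpace ℝ V] [FiniteDimensional ℝ V] [MeasurableSpace V] [BorelSpace V] in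
/-- `A` is open. [folklore] -/
theorem isOpen_goodSet [NormedSpace ℝ V] (hu : Continuous u) : IsOpen (goodSet u) :=
  isOpen_Ioo.prod (isOpen_ne_fun hu continuous_const)

omit [InnerProductSpace ℝ K] [FiniteDimensional ℝ K] [MeasurableSpace K] [BorelSpace K]
  [InnerProductSpace ℝ V] [FiniteDimensional ℝ V] [MeasurableSpace V] [BorelSpace V] in
/-- `A` is bounded when `u` has compact support. [folklore] -/
theorem isBounded_goodSet [NormedSpace ℝ V] (hus : HasCompactSupport u) :
    Bornology.IsBounded (goodSet u) := by
  refine (Metric.isBounded_Ioo 0 1).prod (hus.isBounded.subset fun k hk => ?_)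
  exact subset_tsupport _ (Function.mem_support.2 hk)

omit [InnerProductSpace ℝ K] [FiniteDimensional ℝ K] [MeasurableSpace K] [BorelSpace K]
  [InnerProductSpace ℝ V] [FiniteDimensional ℝ V] [MeasurableSpace V] [BorelSpace V] in
/-- `A ⊆ [0,1] × spt u`. [folklore] -/
theorem goodSet_subset [NormedSpace ℝ V] : goodSet u ⊆ Icc (0 : ℝ) 1 ×ˢ tsupport u :=
  Set.prod_mono Ioo_subset_Icc_self fun _ hk => subset_tsupport _ (Function.mem_support.2 hk)

omit [FiniteDimensional ℝ V] in
/-- **The approximate tangent cone of the swept surface is the tangent space**: for `z` in the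
good set, `Tan^{n+1}(𝓗^{n+1} ⌞ Φ(A), Φ z) = im DΦ(z)`. [cite: Federer1969, 3.2.19] -/
theorem approxTangentCone_graphHomotopy_eq (e : OrthonormalBasis (Fin n) ℝ K)
    (hu : ContDiff ℝ ∞ u) (hπι : ∀ k, π₁ (ι k) = k) (hπu : ∀ k, π₁ (u k) = 0)
    {z : ℝ × K} (hz : z ∈ goodSet u) :
    approxTangentCone (n + 1)
        ((μHE[n + 1] : Measure V).restrict (graphHomotopy ι u '' goodSet u))
        (graphHomotopy ι u z) = Set.range (fderiv ℝ (graphHomotopy ι u) z) := by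
  set Φ := graphHomotopy ι u with hΦdef
  have hΦ : ContDiff ℝ ∞ Φ := contDiff_graphHomotopy ι hu
  have huz : u z.2 ≠ 0 := hz.2
  -- the Euclidean parameter space
  set L₂ : WithLp 2 (ℝ × K) ≃L[ℝ] ℝ × K := WithLp.prodContinuousLinearEquiv 2 ℝ ℝ K with hL₂
  have hL₂_apply : ∀ w, L₂ w = ofLp w := fun w => rfl
  have hfin : finrank ℝ (WithLp 2 (ℝ × K)) = n + 1 := finrank_withLp_real_prod e
  set g : WithLp 2 (ℝ × K) → V := fun w => Φ (L₂ w) with hg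
  set t : WithLp 2 (ℝ × K) := L₂.symm z with ht
  have hLt : L₂ t = z := L₂.apply_symm_apply z
  have hgt : g t = Φ z := by simp only [hg, hLt]
  have hgc : ContDiff ℝ ∞ g := hΦ.comp L₂.contDiff
  have hgd : HasFDerivAt g ((fderiv ℝ Φ z).comp (L₂ : WithLp 2 (ℝ × K) →L[ℝ] ℝ × K)) t := by
    have h := ((hΦ.differentiable (by simp)).differentiableAt (x := L₂ t)).hasFDerivAt.comp t
      L₂.hasFDerivAt
    rwa [hLt] at h
  -- the local inverse and its Lipschitz extension
  set ℓ₀ := graphHomotopyInv ι π₁ u with hℓ₀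
  have hy0 : u (π₁ (Φ z)) ≠ 0 := by rwa [hΦdef, apply_pi_graphHomotopy ι π₁ hπι hπu]
  have hℓ₀d : ContDiffAt ℝ ∞ ℓ₀ (Φ z) := contDiffAt_graphHomotopyInv ι π₁ hu hy0
  have h1le : (1 : WithTop ℕ∞) ≤ ((⊤ : ℕ∞) : WithTop ℕ∞) := by exact_mod_cast le_top
  obtain ⟨Kℓ, T₀, hT₀, hℓ₀L⟩ := (hℓ₀d.of_le h1le).exists_lipschitzOnWith
  obtain ⟨ℓ₁, hℓ₁L, hℓ₁eq⟩ := hℓ₀L.extend_finite_dimension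
  set ℓ : V → WithLp 2 (ℝ × K) := fun y => L₂.symm (ℓ₁ y) with hℓ
  have hℓL : LipschitzWith (max (‖(L₂.symm : ℝ × K →L[ℝ] WithLp 2 (ℝ × K))‖₊ *
      (lipschitzExtensionConstant (ℝ × K) * Kℓ)) 1) ℓ :=
    ((L₂.symm : ℝ × K →L[ℝ] WithLp 2 (ℝ × K)).lipschitz.comp hℓ₁L).weaken (le_max_left _ _)
  have hKpos : 0 < max (‖(L₂.symm : ℝ × K →L[ℝ] WithLp 2 (ℝ × K))‖₊ *
      (lipschitzExtensionConstant (ℝ × K) * Kℓ)) 1 := lt_max_of_lt_right one_pos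
  -- the neighbourhood `W` of `t`
  obtain ⟨Lg, W₀, hW₀, hgL⟩ := ((hgc.contDiffAt (x := t)).of_le h1le).exists_lipschitzOnWith
  have hAo : IsOpen (goodSet u) := isOpen_goodSet hu.continuous
  set W : Set (WithLp 2 (ℝ × K)) := W₀ ∩ L₂ ⁻¹' (goodSet u ∩ Φ ⁻¹' T₀) with hW
  have hWn : W ∈ 𝓝 t := by
    refine inter_mem hW₀ (L₂.continuous.continuousAt.preimage_mem_nhds ?_)
    rw [hLt]
    exact inter_mem (hAo.mem_nhds hz) (hΦ.continuous.continuousAt.preimage_mem_nhds hT₀)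
  have hgW : LipschitzOnWith Lg g W := hgL.mono inter_subset_left
  have hℓg : ∀ s ∈ W, ℓ (g s) = s := by
    intro s hs
    have hsA : L₂ s ∈ goodSet u := hs.2.1
    have hsT : Φ (L₂ s) ∈ T₀ := hs.2.2
    simp only [hℓ, hg]
    rw [← hℓ₁eq hsT, hℓ₀, hΦdef, graphHomotopyInv_apply ι π₁ hπι hπu hsA.2]
    exact L₂.symm_apply_apply s
  have hC : g '' W ⊆ Φ '' goodSet u := by
    rintro _ ⟨s, hs, rfl⟩
    exact ⟨L₂ s, hs.2.1, rfl⟩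
  have hCm : MeasurableSet (Φ '' goodSet u) :=
    hAo.measurableSet.image_of_continuousOn_injOn hΦ.continuous.continuousOn
      ((injOn_graphHomotopy ι π₁ hπι hπu).mono fun z hz => hz.2)
  -- the level set `F y = y - Φ (ℓ₀ y)`
  set F : V → V := fun y => y - Φ (ℓ₀ y) with hF
  have hℓ₀z : ℓ₀ (Φ z) = z := graphHomotopyInv_apply ι π₁ hπι hπu huz
  have hFd : HasFDerivAt F (ContinuousLinearMap.id ℝ V -
      (fderiv ℝ Φ z).comp (fderiv ℝ ℓ₀ (Φ z))) (g t) := by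
    rw [hgt]
    have h1 : HasFDerivAt ℓ₀ (fderiv ℝ ℓ₀ (Φ z)) (Φ z) :=
      (hℓ₀d.differentiableAt (by simp)).hasFDerivAt
    have h2 : HasFDerivAt Φ (fderiv ℝ Φ (ℓ₀ (Φ z))) (ℓ₀ (Φ z)) :=
      ((hΦ.differentiable (by simp)).differentiableAt).hasFDerivAt
    have h3 := h2.comp (Φ z) h1
    rw [hℓ₀z] at h3
    exact (hasFDerivAt_id (Φ z)).sub h3
  have hCU : Φ '' goodSet u ∩ univ ⊆ {y | F y = F (g t)} := by
    rintro _ ⟨⟨z', hz', rfl⟩, -⟩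
    simp only [mem_setOf_eq, hF, hgt, hℓ₀]
    rw [hΦdef, graphHomotopyInv_apply ι π₁ hπι hπu hz'.2, graphHomotopyInv_apply ι π₁ hπι hπu huz,
      sub_self, sub_self]
  have hker : ∀ y, (ContinuousLinearMap.id ℝ V - (fderiv ℝ Φ z).comp (fderiv ℝ ℓ₀ (Φ z))) y = 0 →
      y ∈ Set.range ((fderiv ℝ Φ z).comp (L₂ : WithLp 2 (ℝ × K) →L[ℝ] ℝ × K)) := by
    intro y hy
    rw [_root_.sub_apply, sub_eq_zero] at hy
    refine ⟨L₂.symm (fderiv ℝ ℓ₀ (Φ z) y), ?_⟩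
    simp only [ContinuousLinearMap.coe_comp, ContinuousLinearEquiv.coe_coe, Function.comp_apply,
      ContinuousLinearEquiv.apply_symm_apply]
    exact hy.symm
  have key := approxTangentCone_eq_range_fderiv_of_lipschitz (G := V) hKpos hℓL hWn hgW hℓg hgd hC
    hCm MeasurableSet.univ univ_mem hFd hCU hker
  rw [hfin, hgt] at key
  rw [key]
  -- `range (DΦ z ∘ L₂) = range (DΦ z)`
  ext y
  constructor
  · rintro ⟨w, rfl⟩
    exact ⟨L₂ w, rfl⟩
  · rintro ⟨c, rfl⟩
    exact ⟨L₂.symm c, by simp⟩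

end Tangent

/-! ### The homotopy current is a rectifiable current -/

section Current

variable {K : Type*} [NormedAddCommGroup K] [InnerProductSpace ℝ K] [FiniteDimensional ℝ K]
  [MeasurableSpace K] [BorelSpace K]
  {V : Type*} [NormedAddCommGroup V] [InnerProductSpace ℝ V] [FiniteDimensional ℝ V]
  [MeasurableSpace V] [BorelSpace V] {n : ℕ}
  (ι : K →L[ℝ] V) (π₁ : V →L[ℝ] K) {u : K → V}

omit [InnerProductSpace ℝ V] [FiniteDimensional ℝ V] [MeasurableSpace V] [BorelSpace V] in
/-- **From the slab to the good set**: an integrand vanishing where `u = 0` integrates over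
`(vol ⌞ [0,1]) × vol` as over the good set `(0,1) × {u ≠ 0}`. [folklore] -/
theorem integral_slab_eq_setIntegral_goodSet [NormedSpace ℝ V]
    {F : ℝ × K → ℝ} (hF : ∀ z : ℝ × K, u z.2 = 0 → F z = 0) :
    ∫ z, F z ∂(((volume : Measure ℝ).restrict (Icc 0 1)).prod (volume : Measure K)) =
      ∫ z in goodSet u, F z ∂((volume : Measure ℝ).prod (volume : Measure K)) := by
  have h1 : ((volume : Measure ℝ).restrict (Icc 0 1)).prod (volume : Measure K) =
      ((volume : Measure ℝ).prod (volume : Measure K)).restrict (Icc (0 : ℝ) 1 ×ˢ univ) := by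
    conv_lhs => rw [← Measure.restrict_univ (μ := (volume : Measure K))]
    rw [Measure.prod_restrict]
  rw [h1]
  -- `[0,1] × K` and `(0,1) × K` differ by a null set
  have hnull : ((volume : Measure ℝ).prod (volume : Measure K))
      ((Icc (0 : ℝ) 1 ×ˢ (univ : Set K)) \ (Ioo (0 : ℝ) 1 ×ˢ (univ : Set K))) = 0 := by
    have hsub : (Icc (0 : ℝ) 1 ×ˢ (univ : Set K)) \ (Ioo (0 : ℝ) 1 ×ˢ (univ : Set K)) ⊆
        ({0, 1} : Set ℝ) ×ˢ (univ : Set K) := by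
      rintro ⟨t, k⟩ ⟨⟨ht, -⟩, h2⟩
      refine ⟨?_, mem_univ _⟩
      simp only [mem_prod, mem_univ, and_true, mem_Ioo, not_and, not_lt] at h2
      rcases eq_or_lt_of_le ht.1 with h | h
      · exact Or.inl h.symm
      · exact Or.inr (le_antisymm ht.2 (h2 h))
    refine measure_mono_null hsub ?_
    rw [Measure.prod_prod]
    have h0 : (volume : Measure ℝ) ({0, 1} : Set ℝ) = 0 :=
      (Set.toFinite _).measure_zero _
    rw [h0, zero_mul]
  have h2 : (Icc (0 : ℝ) 1 ×ˢ (univ : Set K) : Set (ℝ × K)) =ᵐ[(volume : Measure ℝ).prod volume]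
      (Ioo (0 : ℝ) 1 ×ˢ (univ : Set K) : Set (ℝ × K)) := by
    refine (ae_eq_set.2 ⟨?_, hnull⟩).symm
    rw [Set.sdiff_eq_empty.2 (Set.prod_mono Ioo_subset_Icc_self le_rfl), measure_empty]
  rw [setIntegral_congr_set h2]
  refine setIntegral_eq_of_subset_of_forall_sdiff_eq_zero (measurableSet_Ioo.prod MeasurableSet.univ)
    (Set.prod_mono le_rfl (subset_univ _)) ?_
  rintro z ⟨hz, hzA⟩
  refine hF z ?_
  by_contra h
  exact hzA ⟨hz.1, h⟩

omit [InnerProductSpace ℝ V] [FiniteDimensional ℝ V] [MeasurableSpace V] [BorelSpace V] in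
/-- **From the good set to the Euclidean parameter space**: transport along the measure-preserving
`ofLp : WithLp 2 (ℝ × K) → ℝ × K`. [folklore] -/
theorem setIntegral_goodSet_eq_withLp [NormedSpace ℝ V] (F : ℝ × K → ℝ) :
    ∫ z in goodSet u, F z ∂((volume : Measure ℝ).prod (volume : Measure K)) =
      ∫ w in (ofLp : WithLp 2 (ℝ × K) → ℝ × K) ⁻¹' goodSet u, F (ofLp w) := by
  have h := (WithLp.volume_preserving_ofLp ℝ K).setIntegral_preimage_emb
    (MeasurableEquiv.toLp 2 (ℝ × K)).symm.measurableEmbedding F (goodSet u)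
  exact h.symm

/-- **The graph homotopy current is rectifiable.** In the situation of
`exists_graphHomotopyCurrent` (with `μ = vol`), if `π₁ ∘ ι = id` and `π₁ ∘ u = 0` for a
continuous linear `π₁`, and `Φ([0,1] × spt u) ⊆ Ω'`, then the homotopy current `S` — with its
formula, homotopy formula, mass bound and support bound — is such that `k • S` is a rectifiable
current for every `k : ℤ` (the current of integration over the swept surface `Φ((0,1) × {u ≠ 0})`
with multiplicity `k` and the Gram–Schmidt push-forward frame). [cite: Federer1969, 4.1.9, 4.1.28] -/
theorem exists_graphHomotopyCurrent_isRectifiable (e : OrthonormalBasis (Fin n) ℝ K)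
    (hu : ContDiff ℝ ∞ u) (hus : HasCompactSupport u) (hπι : ∀ k, π₁ (ι k) = k)
    (hπu : ∀ k, π₁ (u k) = 0) {Kc : Set K} (hKc : IsCompact Kc) {Ω' : Opens V}
    (hΩ : graphHomotopy ι u '' (Icc (0 : ℝ) 1 ×ˢ tsupport u) ⊆ Ω') :
    ∃ S : Current Ω' (n + 1),
      (∀ φ : TestForm Ω' (n + 1), S φ =
        ∫ z, φ (ι z.2 + z.1 • u z.2)
            (Fin.cons (u z.2) fun j => ι (e j) + z.1 • fderiv ℝ u z.2 (e j))
          ∂(((volume : Measure ℝ).restrict (Icc 0 1)).prod (volume : Measure K))) ∧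
      (∀ φ : TestForm Ω' n, (∀ x, x ∉ Kc → φ (ι x) = 0) →
        S.boundary φ =
          (∫ x, φ (ι x + u x) (fun j => ι (e j) + fderiv ℝ u x (e j))) -
            ∫ x, φ (ι x) (fun j => ι (e j))) ∧
      S.mass ≤ ENNReal.ofReal (∫ z, ‖u z.2‖ * ∏ j, ‖ι (e j) + z.1 • fderiv ℝ u z.2 (e j)‖
          ∂(((volume : Measure ℝ).restrict (Icc 0 1)).prod (volume : Measure K))) ∧
      S.support ⊆ graphHomotopy ι u '' (Icc (0 : ℝ) 1 ×ˢ tsupport u) ∧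
      ∀ k : ℤ, ((k : ℝ) • S).IsRectifiable := by
  obtain ⟨S, hS, hSb, hSm, hSs⟩ :=
    exists_graphHomotopyCurrent (volume : Measure K) e ι hu hus hKc Ω'
  refine ⟨S, hS, hSb, hSm, hSs, fun k => ?_⟩
  set Φ := graphHomotopy ι u with hΦdef
  have hΦ : ContDiff ℝ ∞ Φ := contDiff_graphHomotopy ι hu
  have hΦd : ∀ z, HasFDerivAt Φ (fderiv ℝ Φ z) z := fun z =>
    ((hΦ.differentiable (by simp)).differentiableAt).hasFDerivAt
  -- the Euclidean parametrisation `g = Φ ∘ ofLp` of the swept surface over `A₂ = ofLp⁻¹ A`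
  set L₂ : WithLp 2 (ℝ × K) ≃L[ℝ] ℝ × K := WithLp.prodContinuousLinearEquiv 2 ℝ ℝ K with hL₂
  have hL₂_apply : ∀ w, L₂ w = ofLp w := fun w => rfl
  set g : WithLp 2 (ℝ × K) → V := fun w => Φ (L₂ w) with hg
  set g' : WithLp 2 (ℝ × K) → WithLp 2 (ℝ × K) →L[ℝ] V := fun w =>
    (fderiv ℝ Φ (L₂ w)).comp (L₂ : WithLp 2 (ℝ × K) →L[ℝ] ℝ × K) with hg'
  set A₂ : Set (WithLp 2 (ℝ × K)) := L₂ ⁻¹' goodSet u with hA₂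
  have hAo : IsOpen (goodSet u) := isOpen_goodSet hu.continuous
  have hA₂o : IsOpen A₂ := hAo.preimage L₂.continuous
  have hA₂m : MeasurableSet A₂ := hA₂o.measurableSet
  have hgd : ∀ w ∈ A₂, HasFDerivWithinAt g (g' w) A₂ w := fun w _ =>
    ((hΦd (L₂ w)).comp w L₂.hasFDerivAt).hasFDerivWithinAt
  have hginj : ∀ w ∈ A₂, Injective (g' w) := fun w hw =>
    (injective_fderiv_graphHomotopy ι π₁ hu hπι hπu (z := L₂ w) hw.2).comp L₂.injective
  have hgi : InjOn g A₂ := fun a ha b hb h =>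
    L₂.injective ((injOn_graphHomotopy ι π₁ hπι hπu) ha.2 hb.2 h)
  have himage : g '' A₂ = Φ '' goodSet u := by
    ext y
    constructor
    · rintro ⟨w, hw, rfl⟩
      exact ⟨L₂ w, hw, rfl⟩
    · rintro ⟨z, hz, rfl⟩
      exact ⟨L₂.symm z, by simp [hA₂, hz], by simp [hg]⟩
  -- boundedness: `A ⊆ [0,1] × spt u` compact
  have hKc' : IsCompact (Icc (0 : ℝ) 1 ×ˢ tsupport u) := isCompact_Icc.prod hus
  obtain ⟨C₀, hC₀⟩ := hKc'.exists_bound_of_continuousOn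
    ((hΦ.continuous_fderiv (by simp)).continuousOn)
  have hC : ∀ w ∈ A₂, ‖g' w‖ ≤ max C₀ 0 * ‖(L₂ : WithLp 2 (ℝ × K) →L[ℝ] ℝ × K)‖ := by
    intro w hw
    refine (ContinuousLinearMap.opNorm_comp_le _ _).trans ?_
    exact mul_le_mul_of_nonneg_right ((hC₀ _ (goodSet_subset hw)).trans (le_max_left _ _))
      (norm_nonneg _)
  have hA₂b : Bornology.IsBounded A₂ := by
    have : A₂ = L₂.symm '' goodSet u := by
      rw [hA₂, ← L₂.image_symm_eq_preimage]
    rw [this]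
    exact (L₂.symm : ℝ × K →L[ℝ] WithLp 2 (ℝ × K)).lipschitz.isBounded_image
      (isBounded_goodSet hus)
  have hA₂fin : volume A₂ ≠ ⊤ := hA₂b.measure_lt_top.ne
  -- the push-forward frame
  set e₂ := slabBasisL2 e with he₂
  obtain ⟨ξ, hξ, -⟩ := exists_frame_image (f := g) (f' := g') (s := A₂) hgi e₂
  have hframe : ∀ w, (fun i => g' w (e₂ i)) =
      Fin.cons (u (L₂ w).2) fun j => ι (e j) + (L₂ w).1 • fderiv ℝ u (L₂ w).2 (e j) := by
    intro w
    rw [← fderiv_graphHomotopy_slabFrame ι hu e (L₂ w)]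
    funext i
    simp only [hg', he₂, slabBasisL2_apply, ContinuousLinearMap.coe_comp, Function.comp_apply,
      ContinuousLinearEquiv.coe_coe, hL₂_apply, hΦdef]
  -- `k • S` is the current of integration over the swept surface
  have hkS : ((k : ℝ) • S : Current Ω' (n + 1)) =
      currentOfIntegration (Φ '' goodSet u) (fun _ => k) ξ := by
    ext φ
    rw [← himage, currentOfIntegration_image_apply hA₂m hgd hginj hgi e₂ hξ hC hA₂fin k φ]
    change (k : ℝ) * S φ = _
    rw [hS φ]
    congr 1
    have hF0 : ∀ z : ℝ × K, u z.2 = 0 → (φ (ι z.2 + z.1 • u z.2)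
        (Fin.cons (u z.2) fun j => ι (e j) + z.1 • fderiv ℝ u z.2 (e j))) = 0 := by
      intro z hz
      exact (φ _).map_coord_zero 0 (by rw [Fin.cons_zero, hz])
    rw [integral_slab_eq_setIntegral_goodSet hF0, setIntegral_goodSet_eq_withLp]
    refine setIntegral_congr_fun hA₂m fun w _ => ?_
    simp only [hframe w, hg, hΦdef, graphHomotopy_apply, hL₂_apply]
  -- admissible rectifiable data
  have hΩ' : Φ '' goodSet u ⊆ Ω' := (image_mono goodSet_subset).trans hΩ
  have hWm : MeasurableSet (Φ '' goodSet u) := by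
    rw [← himage]
    exact measurableSet_image_of_hasFDerivWithinAt hA₂m hgd hgi
  have hdata : IsRectifiableData Ω' (n + 1) (Φ '' goodSet u) (fun _ => k) ξ := by
    refine ⟨hWm, hΩ', ?_, ?_, ?_⟩
    · rw [← himage]
      exact isCountablyRectifiable_image_of_hasFDerivWithinAt e₂ hgd
    · rw [← himage]
      exact ((integrableOn_smul_frameVector_image hA₂m hgd hginj hgi e₂ hξ hC hA₂fin
        (k : ℝ)).integrable.locallyIntegrable).locallyIntegrableOn _
    · rw [ae_restrict_iff' hWm, ← himage]
      refine Eventually.of_forall ?_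
      rintro _ ⟨w, hw, rfl⟩
      rw [hξ w hw]
      refine ⟨orthonormal_gramSchmidtNormed_comp (hginj w hw) e₂, ?_⟩
      rw [span_gramSchmidtNormed_comp, LinearMap.coe_range, himage]
      have ht := approxTangentCone_graphHomotopy_eq ι π₁ e hu hπι hπu (z := L₂ w) hw
      rw [show g w = Φ (L₂ w) from rfl, ht]
      ext y
      simp only [hg', ContinuousLinearMap.coe_coe, Set.mem_range, ContinuousLinearMap.coe_comp,
        Function.comp_apply, ContinuousLinearEquiv.coe_coe]
      constructor
      · rintro ⟨w', rfl⟩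
        exact ⟨L₂ w', rfl⟩
      · rintro ⟨c, rfl⟩
        exact ⟨L₂.symm c, by simp [hΦdef]⟩
  refine ⟨⟨_, _, _, hdata, hkS⟩, ?_⟩
  -- compact support
  have hK : IsCompact (Φ '' (Icc (0 : ℝ) 1 ×ˢ tsupport u)) := hKc'.image hΦ.continuous
  refine Current.isCompact_support_of_subset _ hK hΩ ?_
  rw [hkS]
  exact (support_currentOfIntegration_subset_closure _ _ _).trans
    (closure_minimal (image_mono goodSet_subset) hK.isClosed)

end Current

end Literature.Geometry.GeometricMeasureTheory
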